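import Summits.ValiantsHypothesis.ValiantsHypothesis.Theorems.LacunarySymmetroidMatrixDescartesCensusV20Check
import Summits.ValiantsHypothesis.ValiantsHypothesis.Theorems.LacunarySymmetroidMatrixDescartesCensusV20Box24Keys

/-!
# `MatrixDescartes` census — BOX24, `V = 20` layer: COVER CHECK B (`21 ≤ d₅ ≤ 24`) (every 2-Sidon support is a key or a mirror of one)

HONEST FRAMING.  Object-search cell `pub-symmetroid`; door-A item `DoorA26 = PosRootLawAt 2 6 19`
(stmt-ValiantsHypothesis-19979; OPEN, typed, never asserted).  Kernel check (`decide +kernel` of `V20.coverSlices`, `…CensusV20Check`): for the listed slices `(d₅, d₄-range)` of the box of sorted supports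
`0 = d₀ < ⋯ < d₅ ≤ 24`, every support whose 21 pair sums are distinct is a key of `…CensusV20Box24Keys` or the mirror of one.  Pure
enumeration bookkeeping; soundness `V20.box_of_plan` (`…CensusV20SoundTwenty`), use `…CensusV20Box24`.  Nothing here bears on `V = 19`, on `ζ_sym(2,6)` over all supports, on `DoorA26` itself, on `MatrixDescartes`
(stmt-ValiantsHypothesis-18050) or on `VP ≠ VNP`.

[folklore] Certificate-checker soundness / replay; elementary.
-/

-- the D-0017 layout repeats a namespace component (single-conjunct summit); the `dupNamespace` linter flags it; name mandated.
set_option linter.dupNamespace false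

namespace Summit.ValiantsHypothesis.ValiantsHypothesis.Theorems.LacunarySymmetroidMatrixDescartes.Census.V20

/-- Cover check of the slices `[(21, 4, 20), (22, 4, 21)]` against `box24Keys`. [folklore] -/
theorem cover24_b1 : coverSlices box24Keys [(21, 4, 20), (22, 4, 21)] = true := by decide +kernel

/-- Cover check of the slices `[(23, 4, 22)]` against `box24Keys`. [folklore] -/
theorem cover24_b2 : coverSlices box24Keys [(23, 4, 22)] = true := by decide +kernel

/-- Cover check of the slices `[(24, 4, 23)]` against `box24Keys`. [folklore] -/
theorem cover24_b3 : coverSlices box24Keys [(24, 4, 23)] = true := by decide +kernel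

end Summit.ValiantsHypothesis.ValiantsHypothesis.Theorems.LacunarySymmetroidMatrixDescartes.Census.V20
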